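import Summits.ResolutionOfSingularities.ResolutionOfSingularities.Theorems.RadicialJungCleanModelsGiraudTotalColength
import HarnessLib

/-!
# Route `RadicialJung`, crux `CleanModels` (stmt-15917): Giraud's Lemme 2.1.1 — bridge to the
# chart rings `R[y/x]` and their weak transforms

Support file (OURS) for PROGRAMME-clean-dim2 (brick K2 (α), W8.1), companion of
`RadicialJungCleanModelsGiraudTotalColength.lean`. There Giraud's Lemme 2.1.1 is stated with the
`R`-modules `𝔪ʳ𝒜/J𝒜` (`𝒜 = R[y/x]` as an `R`-submodule of `K`), whose `R`-length is the
residue-degree-weighted total colength of the weak transform on the chart. Here we connect this to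
the chart RING `A = chartAdjoin x y = R[y/x] ⊆ K` and its weak-transform IDEAL
`Jᴬ = (JA : xʳ) = weakTransformChart x y J r` of `QuadraticTransformWeakTransform.lean`:

* `mem_map_chartIncl_iff_mem_smul` — the ideal `JA` of `A` and the `R`-submodule `J · 𝒜` of
  `K` have the same elements;
* `length_quotient_weakTransformChart_le` — **`λ_A(A/Jᴬ) ≤ λ_R(𝔪ʳ𝒜/J𝒜)`**: the UNWEIGHTED
  total colength of the weak transform on the chart (the `A`-length, a sum of local colengths
  without residue degrees) is at most the weighted one (`A/Jᴬ ≅ xʳA/JA = 𝔪ʳ𝒜/J𝒜` by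
  multiplication by `xʳ`, and an `A`-composition series is an `R`-filtration);
* `length_quotient_weakTransformChart_charts_add_choose_le` — hence Giraud's inequality with the
  two unweighted chart colengths: `λ_A(A/Jᴬ) + λ_B(B/Jᴮ) + r(r+1)/2 ≤ λ_R(R/J) + λ_R(overlap)`.

References: J. Giraud, Bull. SMF 111 (1983), Lemme 2.1.1; C. Huneke, I. Swanson, *Integral
Closure of Ideals, Rings, and Modules* (2006), Lemma 14.3.4. Nothing here is a statement of
Hironaka's manuscript or bears on the summit directly.
-/

noncomputable section

set_option linter.dupNamespace false -- mandated namespace of this single-conjunct summit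

open IsLocalRing Literature.AlgebraicGeometry.Resolution

namespace Summit.ResolutionOfSingularities.ResolutionOfSingularities.Theorems.RadicialJung.CleanModels

universe u

variable {K : Type u} [Field K] {R : Subring K} {x y : R}

/-- **The ideal `JA ⊆ A = R[y/x]` and the `R`-submodule `J · R[y/x] ⊆ K` have the same
elements.** [folklore] -/
theorem mem_map_chartIncl_iff_mem_smul (J : Ideal R) {z : K} (hz : z ∈ chartAdjoin (K := K) x y) :
    (⟨z, hz⟩ : chartAdjoin (K := K) x y) ∈ J.map (chartIncl x y) ↔
      z ∈ J • Subalgebra.toSubmodule (Algebra.adjoin R {((y : R) : K) / ((x : R) : K)}) := by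
  set 𝒜 := Subalgebra.toSubmodule (Algebra.adjoin R {((y : R) : K) / ((x : R) : K)})
  constructor
  · -- the ideal generated by `ι(J)` is contained in the (𝒜-stable) submodule `J · 𝒜`
    suffices h : ∀ w : chartAdjoin (K := K) x y, w ∈ J.map (chartIncl x y) → (w : K) ∈ J • 𝒜 from
      fun hw => h _ hw
    intro w hw
    rw [Ideal.map] at hw
    refine Submodule.span_induction
      (p := fun (w : chartAdjoin (K := K) x y) _ => (w : K) ∈ J • 𝒜) ?_ ?_ ?_ ?_ hw
    · rintro _ ⟨j, hj, rfl⟩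
      change ((j : R) : K) ∈ J • 𝒜
      rw [show ((j : R) : K) = j • (1 : K) by rw [Algebra.smul_def, mul_one]; rfl]
      exact Submodule.smul_mem_smul hj (Subalgebra.one_mem _)
    · exact (J • 𝒜).zero_mem
    · intro a b _ _ ha hb
      exact (J • 𝒜).add_mem ha hb
    · intro a w _ hw
      change (a : K) * (w : K) ∈ J • 𝒜
      refine Submodule.smul_induction_on (p := fun v => (a : K) * v ∈ J • 𝒜) hw ?_ ?_
      · intro j hj v hv
        rw [mul_smul_comm]
        exact Submodule.smul_mem_smul hj ((Algebra.adjoin R _).mul_mem a.2 hv)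
      · intro v v' hv hv'
        rw [mul_add]
        exact (J • 𝒜).add_mem hv hv'
  · intro hzJ
    suffices h : ∀ v ∈ J • 𝒜, ∃ hv : v ∈ chartAdjoin (K := K) x y,
        (⟨v, hv⟩ : chartAdjoin (K := K) x y) ∈ J.map (chartIncl x y) by
      obtain ⟨_, h⟩ := h z hzJ
      exact h
    intro v hv
    refine Submodule.smul_induction_on (p := fun v => ∃ hv : v ∈ chartAdjoin (K := K) x y,
      (⟨v, hv⟩ : chartAdjoin (K := K) x y) ∈ J.map (chartIncl x y)) hv ?_ ?_
    · intro j hj a ha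
      have hja : j • a ∈ chartAdjoin (K := K) x y := (Algebra.adjoin R _).smul_mem ha j
      refine ⟨hja, ?_⟩
      have e : (⟨j • a, hja⟩ : chartAdjoin (K := K) x y) = ⟨a, ha⟩ * chartIncl x y j := by
        apply Subtype.ext
        simp [Algebra.smul_def, Algebra.algebraMap_ofSubsemiring_apply, mul_comm]
      rw [e]
      exact Ideal.mul_mem_left _ _ (Ideal.mem_map_of_mem _ hj)
    · rintro v v' ⟨hv, h⟩ ⟨hv', h'⟩
      exact ⟨add_mem hv hv', Ideal.add_mem _ h h'⟩

section Local

variable [IsLocalRing R]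

/-- **Unweighted ≤ weighted: `λ_A(A/Jᴬ) ≤ λ_R(𝔪ʳ𝒜/J𝒜)`** for `A = R[y/x]`, `𝒜` its underlying
`R`-submodule of `K`, `J` any ideal of `R` and `Jᴬ = (JA : xʳ)` the weak transform:
multiplication by `xʳ` identifies `A/Jᴬ` with `xʳA/(JA ∩ xʳA)`, which as an `R`-module is
`𝔪ʳ𝒜/(J𝒜 ∩ 𝔪ʳ𝒜)` (`maximalIdeal_pow_smul_toSubmodule_adjoin`, `mem_map_chartIncl_iff_mem_smul`),
and the length over `A` of an `A`-module is at most its length over `R`.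
[cite: Giraud1983, Lemme 2.1.1] -/
theorem length_quotient_weakTransformChart_le (hm : maximalIdeal R = Ideal.span {x, y})
    (hx0 : x ≠ 0) (J : Ideal R) (r : ℕ) {𝒜 : Submodule R K}
    (h𝒜 : 𝒜 = Subalgebra.toSubmodule (Algebra.adjoin R {((y : R) : K) / ((x : R) : K)})) :
    Module.length (chartAdjoin (K := K) x y)
        (chartAdjoin (K := K) x y ⧸ weakTransformChart x y J r) ≤
      Module.length R
        (↥(maximalIdeal R ^ r • 𝒜) ⧸ (J • 𝒜).comap (maximalIdeal R ^ r • 𝒜).subtype) := by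
  subst h𝒜
  set 𝒜 := Subalgebra.toSubmodule (Algebra.adjoin R {((y : R) : K) / ((x : R) : K)}) with h𝒜
  letI : Algebra R (chartAdjoin (K := K) x y) := (chartIncl x y).toAlgebra
  set x' : chartAdjoin (K := K) x y := chartIncl x y x with hx'
  set JS : Ideal (chartAdjoin (K := K) x y) := J.map (chartIncl x y) with hJS
  -- `σ : A → A/JA`, `s ↦ xʳ s`, with kernel `Jᴬ`
  let σ : chartAdjoin (K := K) x y →ₗ[chartAdjoin (K := K) x y] chartAdjoin (K := K) x y ⧸ JS :=
    (Submodule.mkQ JS).comp (LinearMap.mulLeft _ (x' ^ r))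
  have hσ : ∀ s, σ s = Submodule.Quotient.mk (x' ^ r * s) := fun s => rfl
  have hkerσ : LinearMap.ker σ = weakTransformChart x y J r := by
    ext s
    rw [LinearMap.mem_ker, hσ, Submodule.Quotient.mk_eq_zero, Submodule.mem_colon_singleton,
      smul_eq_mul, mul_comm]
  -- `Φ : 𝔪ʳ𝒜 → A/JA`, `z ↦ z`
  have hle : maximalIdeal R ^ r • 𝒜 ≤ 𝒜 := Submodule.smul_le_right
  let Φ : ↥(maximalIdeal R ^ r • 𝒜) →ₗ[R] chartAdjoin (K := K) x y ⧸ JS :=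
    { toFun := fun z => Submodule.Quotient.mk ⟨(z : K), hle z.2⟩
      map_add' := fun z z' => by
        rw [← Submodule.Quotient.mk_add]
        rfl
      map_smul' := fun c z => by
        rw [RingHom.id_apply, ← Submodule.Quotient.mk_smul]
        congr 1 }
  have hΦ : ∀ z, Φ z = Submodule.Quotient.mk ⟨(z : K), hle z.2⟩ := fun z => rfl
  have hkerΦ : LinearMap.ker Φ = (J • 𝒜).comap (maximalIdeal R ^ r • 𝒜).subtype := by
    ext z
    rw [LinearMap.mem_ker, hΦ, Submodule.Quotient.mk_eq_zero, hJS, mem_map_chartIncl_iff_mem_smul,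
      Submodule.mem_comap, Submodule.subtype_apply]
  have hrange : (LinearMap.range σ).restrictScalars R = LinearMap.range Φ := by
    ext q
    rw [Submodule.restrictScalars_mem, LinearMap.mem_range, LinearMap.mem_range]
    constructor
    · rintro ⟨s, rfl⟩
      have hmem : ((x : R) : K) ^ r * (s : K) ∈ maximalIdeal R ^ r • 𝒜 := by
        rw [maximalIdeal_pow_smul_toSubmodule_adjoin hm hx0,
          mem_span_singleton_smul_toSubmodule_iff]
        exact ⟨s, s.2, by rw [Subring.coe_pow]⟩
      refine ⟨⟨_, hmem⟩, ?_⟩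
      exact (hΦ _).trans ((congrArg Submodule.Quotient.mk
        (Subtype.ext (by simp [hx']))).trans (hσ s).symm)
    · rintro ⟨⟨w, hw⟩, rfl⟩
      have hw' := hw
      rw [maximalIdeal_pow_smul_toSubmodule_adjoin hm hx0,
        mem_span_singleton_smul_toSubmodule_iff] at hw'
      obtain ⟨a, ha, hwa⟩ := hw'
      rw [Subring.coe_pow] at hwa
      refine ⟨⟨a, ha⟩, ?_⟩
      exact (hσ _).trans ((congrArg Submodule.Quotient.mk
        (Subtype.ext (by simpa [hx'] using hwa))).trans (hΦ _).symm)
  calc Module.length (chartAdjoin (K := K) x y)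
        (chartAdjoin (K := K) x y ⧸ weakTransformChart x y J r)
      = Module.length (chartAdjoin (K := K) x y) (chartAdjoin (K := K) x y ⧸ LinearMap.ker σ) := by
        rw [hkerσ]
    _ = Module.length (chartAdjoin (K := K) x y) (LinearMap.range σ) :=
        (LinearMap.quotKerEquivRange σ).length_eq
    _ ≤ Module.length R ((LinearMap.range σ).restrictScalars R) :=
        Submodule.length_le_length_restrictScalars R _
    _ = Module.length R (LinearMap.range Φ) := by rw [hrange]
    _ = Module.length R (↥(maximalIdeal R ^ r • 𝒜) ⧸ LinearMap.ker Φ) :=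
        (LinearMap.quotKerEquivRange Φ).length_eq.symm
    _ = _ := by rw [hkerΦ]

end Local

/-- **Giraud's Lemme 2.1.1 with unweighted chart colengths.** For a two-dimensional regular local
ring `(R, 𝔪 = (x, y))` of `K`, `J ⊆ 𝔪ʳ`, `A = R[y/x]`, `B = R[x/y]` with weak transforms
`Jᴬ = (JA : xʳ)`, `Jᴮ = (JB : yʳ)`:
`λ_A(A/Jᴬ) + λ_B(B/Jᴮ) + r(r+1)/2 ≤ λ_R(R/J) + λ_R(𝔪ʳ(𝒜+ℬ)/J(𝒜+ℬ))`
(the last term is the weighted colength on the overlap `R[y/x, x/y]` of the two charts).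
[cite: Giraud1983, Lemme 2.1.1] -/
theorem length_quotient_weakTransformChart_charts_add_choose_le [IsRegularLocalRing R]
    (hdim : ringKrullDim R = 2) (hm : maximalIdeal R = Ideal.span {x, y}) {J : Ideal R} {r : ℕ}
    (hJ : J ≤ maximalIdeal R ^ r) {𝒜 ℬ : Submodule R K}
    (h𝒜 : 𝒜 = Subalgebra.toSubmodule (Algebra.adjoin R {((y : R) : K) / ((x : R) : K)}))
    (hℬ : ℬ = Subalgebra.toSubmodule (Algebra.adjoin R {((x : R) : K) / ((y : R) : K)})) :
    Module.length (chartAdjoin (K := K) x y)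
        (chartAdjoin (K := K) x y ⧸ weakTransformChart x y J r) +
      Module.length (chartAdjoin (K := K) y x)
        (chartAdjoin (K := K) y x ⧸ weakTransformChart y x J r) +
      ((r * (r + 1) / 2 : ℕ) : ℕ∞) ≤
    Module.length R (R ⧸ J) +
      Module.length R (↥(maximalIdeal R ^ r • (𝒜 ⊔ ℬ)) ⧸
        (J • (𝒜 ⊔ ℬ)).comap (maximalIdeal R ^ r • (𝒜 ⊔ ℬ)).subtype) := by
  have hm' : maximalIdeal R = Ideal.span {y, x} := hm.trans Ideal.span_pair_comm
  have hx0 : x ≠ 0 := fun h => fst_not_mem_sq hdim hm (by rw [h]; exact Ideal.zero_mem _)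
  have hy0 : y ≠ 0 := fun h => fst_not_mem_sq hdim hm' (by rw [h]; exact Ideal.zero_mem _)
  have hA := length_quotient_weakTransformChart_le (K := K) hm hx0 J r h𝒜
  have hB := length_quotient_weakTransformChart_le (K := K) hm' hy0 J r hℬ
  exact (add_le_add (add_le_add hA hB) le_rfl).trans
    (length_quot_weakTransform_charts_add_choose_le hdim hm hJ h𝒜 hℬ)

end Summit.ResolutionOfSingularities.ResolutionOfSingularities.Theorems.RadicialJung.CleanModels

end
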